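import Summits.RiemannHypothesis.RiemannHypothesis.Theorems.WeilFormatCPolyWindowArch
import HarnessLib

/-!
# Format C, design C∞ (L2–VIII): the archimedean block of two monomial windows through the window constants

Route context: Fourier–Galerkin / Schur-complement certificates of Weil positivity on a window ("format C";
cell memo `run/shared/lean/pub/rh-explicit/rh-explicit-weil-10/FORMATC-DESIGN.md` §1.5, §9.12.7–§9.12.11; supporting
stmt-RiemannHypothesis-0098; seat rh-explicit-weil-10).  `WeilFormatCPolyWindowArch.lean` writes the archimedean block of
`W_a(1x^j, 1x^k)` as `∫_{(0,2a]} ρ(t) K_{jk}(t) dt + 2m_{j+k}∫_{(2a,∞)}ρ` with the window-scale increment polynomial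
`K_{jk}(t) = 2m_{j+k} − O_{jk}(t) − O_{kj}(t)`, `O_{jk}(t) = Σ_{i≤j} C(j,i) t^{j−i}((a−t)^{i+k+1} − (−a)^{i+k+1})/(i+k+1)`
(`WeilFormatCPolyWindowIncrement.integral_add_pow_mul_pow`), `m_n = (a^{n+1} − (−a)^{n+1})/(n+1)`.  The (E) side encloses
such integrals through the WINDOW CONSTANTS `W_p(a) = ∫_{(0,2a]} ρ(t) t^p dt` (`p ≥ 1`; node series in `…Arch.lean`).  This
file performs the binomial bookkeeping once and for all:

* `pow_succ_mul_sub_pow_sub_eq_sum`, `sub_pow_sub_pow_eq_sum` — the expansions of `t^{p+1}((a−t)^n − (−a)^n)` and of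
  `(a−t)^N − a^N` in powers `t^{q+1}`;
* `overlapPoly_sub_moment_eq_sum` — `O_{jk}(t) − m_{j+k}` as an explicit combination of powers `t^{q+1}` (no constant term);
* `setIntegral_weilArchDensity_mul_finset_sum_pow_succ` — linearity of `∫_{(0,2a]} ρ ·` over arbitrary finite sums of
  `d_x t^{e_x+1}`;
* **`setIntegral_weilArchDensity_mul_overlapPoly_sub_moment`** — `∫_{(0,2a]} ρ (O_{jk} − m_{j+k})` as the same combination
  of `W_{q+1}(a)`; and **`setIntegral_weilArchDensity_mul_incrementPoly`** —
  `∫_{(0,2a]} ρ K_{jk} = −∫ρ(O_{jk} − m) − ∫ρ(O_{kj} − m)`, i.e. the archimedean block of two monomial windows as a finite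
  rational-in-`a` combination of the `W_q(a)`.

Pure algebra/calculus; standard axioms; no RH claim.
-/

set_option autoImplicit false
-- `Summit.RiemannHypothesis.RiemannHypothesis.…` is the layout-mandated namespace (summit = problem name).
set_option linter.dupNamespace false

noncomputable section

open Complex Filter Set MeasureTheory
open scoped Real Topology

namespace Summit.RiemannHypothesis.RiemannHypothesis.Theorems.WeilFormatC

open Literature.NumberTheory.LFunctions

variable {a : ℝ}

/-! ## Binomial bookkeeping -/

/-- `t^{p+1}((a−t)^n − (−a)^n) = Σ_{l≤n} C(n,l)(−1)^l a^{n−l} t^{(p+l)+1} − (−a)^n t^{p+1}`. -/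
theorem pow_succ_mul_sub_pow_sub_eq_sum (a t : ℝ) (p n : ℕ) :
    t ^ (p + 1) * ((a - t) ^ n - (-a) ^ n) =
      (∑ l ∈ Finset.range (n + 1), (n.choose l : ℝ) * (-1) ^ l * a ^ (n - l) * t ^ (p + l + 1)) -
        (-a) ^ n * t ^ (p + 1) := by
  have h1 : (a - t) ^ n = ∑ l ∈ Finset.range (n + 1), (-t) ^ l * a ^ (n - l) * (n.choose l : ℝ) := by
    rw [show a - t = -t + a by ring, add_pow]
  rw [h1, mul_sub, Finset.mul_sum]
  congr 1
  · refine Finset.sum_congr rfl fun l _ ↦ ?_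
    rw [neg_pow t]
    ring
  · ring

/-- `(a−t)^N − a^N = Σ_{l<N} C(N,l+1)(−1)^{l+1} a^{N−(l+1)} t^{l+1}`. -/
theorem sub_pow_sub_pow_eq_sum (a t : ℝ) (N : ℕ) :
    (a - t) ^ N - a ^ N =
      ∑ l ∈ Finset.range N, (N.choose (l + 1) : ℝ) * (-1) ^ (l + 1) * a ^ (N - (l + 1)) * t ^ (l + 1) := by
  have h1 : (a - t) ^ N = ∑ l ∈ Finset.range (N + 1), (-t) ^ l * a ^ (N - l) * (N.choose l : ℝ) := by
    rw [show a - t = -t + a by ring, add_pow]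
  rw [h1, Finset.sum_range_succ']
  simp only [pow_zero, Nat.sub_zero, Nat.choose_zero_right, Nat.cast_one, mul_one, one_mul, add_sub_cancel_right]
  refine Finset.sum_congr rfl fun l _ ↦ ?_
  rw [neg_pow t]
  ring

/-- **`O_{jk}(t) − m_{j+k}` in powers of `t`** (every exponent `≥ 1`):
`Σ_{i≤j} C(j,i) t^{j−i}((a−t)^{i+k+1} − (−a)^{i+k+1})/(i+k+1) − (a^{j+k+1} − (−a)^{j+k+1})/(j+k+1)
 = Σ_{i<j} C(j,i)/(i+k+1)·(Σ_{l≤i+k+1} C(i+k+1,l)(−1)^l a^{i+k+1−l} t^{(j−1−i+l)+1} − (−a)^{i+k+1} t^{(j−1−i)+1})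
   + (1/(j+k+1)) Σ_{l<j+k+1} C(j+k+1,l+1)(−1)^{l+1} a^{j+k+1−(l+1)} t^{l+1}`. -/
theorem overlapPoly_sub_moment_eq_sum (a t : ℝ) (j k : ℕ) :
    (∑ i ∈ Finset.range (j + 1), (j.choose i : ℝ) * t ^ (j - i) *
        (((a - t) ^ (i + k + 1) - (-a) ^ (i + k + 1)) / (i + k + 1))) -
      (a ^ (j + k + 1) - (-a) ^ (j + k + 1)) / (j + k + 1) =
      (∑ i ∈ Finset.range j, (j.choose i : ℝ) / (i + k + 1) *
        ((∑ l ∈ Finset.range (i + k + 2), ((i + k + 1).choose l : ℝ) * (-1) ^ l * a ^ (i + k + 1 - l) *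
            t ^ (j - 1 - i + l + 1)) - (-a) ^ (i + k + 1) * t ^ (j - 1 - i + 1))) +
        1 / (j + k + 1) * ∑ l ∈ Finset.range (j + k + 1), ((j + k + 1).choose (l + 1) : ℝ) * (-1) ^ (l + 1) *
          a ^ (j + k + 1 - (l + 1)) * t ^ (l + 1) := by
  rw [Finset.sum_range_succ, Nat.choose_self, Nat.sub_self, pow_zero, Nat.cast_one, one_mul, one_mul]
  have htop : ((a - t) ^ (j + k + 1) - (-a) ^ (j + k + 1)) / ((j : ℝ) + k + 1) -
      (a ^ (j + k + 1) - (-a) ^ (j + k + 1)) / (j + k + 1) =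
      1 / (j + k + 1) * ∑ l ∈ Finset.range (j + k + 1), ((j + k + 1).choose (l + 1) : ℝ) * (-1) ^ (l + 1) *
          a ^ (j + k + 1 - (l + 1)) * t ^ (l + 1) := by
    rw [← sub_pow_sub_pow_eq_sum]
    ring
  have hlow : ∀ i ∈ Finset.range j, (j.choose i : ℝ) * t ^ (j - i) *
      (((a - t) ^ (i + k + 1) - (-a) ^ (i + k + 1)) / (i + k + 1)) =
      (j.choose i : ℝ) / (i + k + 1) *
        ((∑ l ∈ Finset.range (i + k + 2), ((i + k + 1).choose l : ℝ) * (-1) ^ l * a ^ (i + k + 1 - l) *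
            t ^ (j - 1 - i + l + 1)) - (-a) ^ (i + k + 1) * t ^ (j - 1 - i + 1)) := by
    intro i hi
    have hij : j - i = (j - 1 - i) + 1 := by
      have := Finset.mem_range.1 hi
      omega
    rw [hij, ← pow_succ_mul_sub_pow_sub_eq_sum a t (j - 1 - i) (i + k + 1)]
    ring
  rw [Finset.sum_congr rfl hlow, add_sub_assoc, htop]

/-! ## Linearity over arbitrary finite sums of powers -/

/-- `∫_{(0,2a]} ρ(t)·(Σ_{x∈s} d_x t^{e_x+1}) dt = Σ_{x∈s} d_x W_{e_x+1}(a)` for any finite index set (`a > 0`). -/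
theorem setIntegral_weilArchDensity_mul_finset_sum_pow_succ (ha : 0 < a) {ι : Type*} (s : Finset ι) (d : ι → ℝ)
    (e : ι → ℕ) :
    ∫ t in Ioc 0 (2 * a), weilArchDensity t * ∑ x ∈ s, d x * t ^ (e x + 1) =
      ∑ x ∈ s, d x * ∫ t in Ioc 0 (2 * a), weilArchDensity t * t ^ (e x + 1) := by
  have hI : ∀ x ∈ s, IntegrableOn (fun t ↦ d x * (weilArchDensity t * t ^ (e x + 1))) (Ioc 0 (2 * a)) :=
    fun x _ ↦ (integrableOn_weilArchDensity_mul_pow_succ ha (e x)).const_mul (d x)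
  have hpt : ∀ t : ℝ, weilArchDensity t * ∑ x ∈ s, d x * t ^ (e x + 1) =
      ∑ x ∈ s, d x * (weilArchDensity t * t ^ (e x + 1)) := by
    intro t
    rw [Finset.mul_sum]
    exact Finset.sum_congr rfl fun x _ ↦ by ring
  simp_rw [hpt]
  rw [integral_finsetSum _ hI]
  exact Finset.sum_congr rfl fun x _ ↦ MeasureTheory.integral_const_mul _ _

/-- The inner polynomial of `overlapPoly_sub_moment_eq_sum` is `ρ`-integrable on `(0, 2a]` (`a > 0`). -/
theorem integrableOn_weilArchDensity_mul_innerPoly (ha : 0 < a) (j k i : ℕ) :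
    IntegrableOn (fun t ↦ weilArchDensity t *
      ((∑ l ∈ Finset.range (i + k + 2), ((i + k + 1).choose l : ℝ) * (-1) ^ l * a ^ (i + k + 1 - l) *
          t ^ (j - 1 - i + l + 1)) - (-a) ^ (i + k + 1) * t ^ (j - 1 - i + 1))) (Ioc 0 (2 * a)) := by
  have h1 : IntegrableOn (fun t ↦ ∑ l ∈ Finset.range (i + k + 2),
      (((i + k + 1).choose l : ℝ) * (-1) ^ l * a ^ (i + k + 1 - l)) * (weilArchDensity t * t ^ (j - 1 - i + l + 1)))
      (Ioc 0 (2 * a)) :=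
    integrable_finsetSum _ fun l _ ↦ (integrableOn_weilArchDensity_mul_pow_succ ha (j - 1 - i + l)).const_mul _
  have h2 : IntegrableOn (fun t ↦ (-a) ^ (i + k + 1) * (weilArchDensity t * t ^ (j - 1 - i + 1))) (Ioc 0 (2 * a)) :=
    (integrableOn_weilArchDensity_mul_pow_succ ha (j - 1 - i)).const_mul _
  refine (h1.sub h2).congr_fun (fun t _ ↦ ?_) measurableSet_Ioc
  simp only [Pi.sub_apply]
  rw [mul_sub, Finset.mul_sum]
  congr 1
  · exact Finset.sum_congr rfl fun l _ ↦ by ring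
  · ring

/-- **`∫_{(0,2a]} ρ (O_{jk} − m_{j+k})` through the window constants** (`a > 0`): the combination of
`overlapPoly_sub_moment_eq_sum` with every `t^{q+1}` replaced by `W_{q+1}(a) = ∫_{(0,2a]} ρ(t) t^{q+1} dt`. -/
theorem setIntegral_weilArchDensity_mul_overlapPoly_sub_moment (ha : 0 < a) (j k : ℕ) :
    ∫ t in Ioc 0 (2 * a), weilArchDensity t *
        ((∑ i ∈ Finset.range (j + 1), (j.choose i : ℝ) * t ^ (j - i) *
            (((a - t) ^ (i + k + 1) - (-a) ^ (i + k + 1)) / (i + k + 1))) -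
          (a ^ (j + k + 1) - (-a) ^ (j + k + 1)) / (j + k + 1)) =
      (∑ i ∈ Finset.range j, (j.choose i : ℝ) / (i + k + 1) *
        ((∑ l ∈ Finset.range (i + k + 2), ((i + k + 1).choose l : ℝ) * (-1) ^ l * a ^ (i + k + 1 - l) *
            ∫ t in Ioc 0 (2 * a), weilArchDensity t * t ^ (j - 1 - i + l + 1)) -
          (-a) ^ (i + k + 1) * ∫ t in Ioc 0 (2 * a), weilArchDensity t * t ^ (j - 1 - i + 1))) +
        1 / (j + k + 1) * ∑ l ∈ Finset.range (j + k + 1), ((j + k + 1).choose (l + 1) : ℝ) * (-1) ^ (l + 1) *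
          a ^ (j + k + 1 - (l + 1)) * ∫ t in Ioc 0 (2 * a), weilArchDensity t * t ^ (l + 1) := by
  simp_rw [overlapPoly_sub_moment_eq_sum]
  -- split the integrand into the `i`-sum and the top term
  have hA : IntegrableOn (fun t ↦ ∑ i ∈ Finset.range j, (j.choose i : ℝ) / (i + k + 1) * (weilArchDensity t *
      ((∑ l ∈ Finset.range (i + k + 2), ((i + k + 1).choose l : ℝ) * (-1) ^ l * a ^ (i + k + 1 - l) *
          t ^ (j - 1 - i + l + 1)) - (-a) ^ (i + k + 1) * t ^ (j - 1 - i + 1)))) (Ioc 0 (2 * a)) :=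
    integrable_finsetSum _ fun i _ ↦ (integrableOn_weilArchDensity_mul_innerPoly ha j k i).const_mul _
  have hB : IntegrableOn (fun t ↦ 1 / ((j : ℝ) + k + 1) * (weilArchDensity t *
      ∑ l ∈ Finset.range (j + k + 1), ((j + k + 1).choose (l + 1) : ℝ) * (-1) ^ (l + 1) *
        a ^ (j + k + 1 - (l + 1)) * t ^ (l + 1))) (Ioc 0 (2 * a)) := by
    have h := integrable_finsetSum (μ := volume.restrict (Ioc 0 (2 * a))) (Finset.range (j + k + 1))
      fun l _ ↦ (integrableOn_weilArchDensity_mul_pow_succ ha l).const_mul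
        (((j + k + 1).choose (l + 1) : ℝ) * (-1) ^ (l + 1) * a ^ (j + k + 1 - (l + 1)))
    refine IntegrableOn.congr_fun (h.const_mul (1 / ((j : ℝ) + k + 1))) (fun t _ ↦ ?_) measurableSet_Ioc
    rw [Finset.mul_sum, Finset.mul_sum, Finset.mul_sum]
    exact Finset.sum_congr rfl fun l _ ↦ by ring
  have hsplit : ∀ t : ℝ, weilArchDensity t *
      ((∑ i ∈ Finset.range j, (j.choose i : ℝ) / (i + k + 1) *
        ((∑ l ∈ Finset.range (i + k + 2), ((i + k + 1).choose l : ℝ) * (-1) ^ l * a ^ (i + k + 1 - l) *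
            t ^ (j - 1 - i + l + 1)) - (-a) ^ (i + k + 1) * t ^ (j - 1 - i + 1))) +
        1 / (j + k + 1) * ∑ l ∈ Finset.range (j + k + 1), ((j + k + 1).choose (l + 1) : ℝ) * (-1) ^ (l + 1) *
          a ^ (j + k + 1 - (l + 1)) * t ^ (l + 1)) =
      (∑ i ∈ Finset.range j, (j.choose i : ℝ) / (i + k + 1) * (weilArchDensity t *
        ((∑ l ∈ Finset.range (i + k + 2), ((i + k + 1).choose l : ℝ) * (-1) ^ l * a ^ (i + k + 1 - l) *
            t ^ (j - 1 - i + l + 1)) - (-a) ^ (i + k + 1) * t ^ (j - 1 - i + 1)))) +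
        1 / ((j : ℝ) + k + 1) * (weilArchDensity t *
          ∑ l ∈ Finset.range (j + k + 1), ((j + k + 1).choose (l + 1) : ℝ) * (-1) ^ (l + 1) *
            a ^ (j + k + 1 - (l + 1)) * t ^ (l + 1)) := by
    intro t
    rw [mul_add, Finset.mul_sum]
    congr 1
    · exact Finset.sum_congr rfl fun i _ ↦ by ring
    · ring
  simp_rw [hsplit]
  rw [integral_add hA hB, integral_finsetSum _ (fun i _ ↦ (integrableOn_weilArchDensity_mul_innerPoly ha j k i).const_mul _),
    MeasureTheory.integral_const_mul, setIntegral_weilArchDensity_mul_finset_sum_pow_succ ha]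
  congr 1
  refine Finset.sum_congr rfl fun i _ ↦ ?_
  rw [MeasureTheory.integral_const_mul]
  congr 1
  have h1 : IntegrableOn (fun t ↦ weilArchDensity t * ∑ l ∈ Finset.range (i + k + 2),
      (((i + k + 1).choose l : ℝ) * (-1) ^ l * a ^ (i + k + 1 - l)) * t ^ (j - 1 - i + l + 1)) (Ioc 0 (2 * a)) := by
    have h := integrable_finsetSum (μ := volume.restrict (Ioc 0 (2 * a))) (Finset.range (i + k + 2))
      fun l _ ↦ (integrableOn_weilArchDensity_mul_pow_succ ha (j - 1 - i + l)).const_mul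
        (((i + k + 1).choose l : ℝ) * (-1) ^ l * a ^ (i + k + 1 - l))
    refine IntegrableOn.congr_fun h (fun t _ ↦ ?_) measurableSet_Ioc
    rw [Finset.mul_sum]
    exact Finset.sum_congr rfl fun l _ ↦ by ring
  have h2 : IntegrableOn (fun t ↦ weilArchDensity t * ((-a) ^ (i + k + 1) * t ^ (j - 1 - i + 1))) (Ioc 0 (2 * a)) := by
    have h := (integrableOn_weilArchDensity_mul_pow_succ ha (j - 1 - i)).const_mul ((-a) ^ (i + k + 1))
    exact IntegrableOn.congr_fun h (fun t _ ↦ by ring) measurableSet_Ioc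
  have hpt : ∀ t : ℝ, weilArchDensity t *
      ((∑ l ∈ Finset.range (i + k + 2), ((i + k + 1).choose l : ℝ) * (-1) ^ l * a ^ (i + k + 1 - l) *
          t ^ (j - 1 - i + l + 1)) - (-a) ^ (i + k + 1) * t ^ (j - 1 - i + 1)) =
      weilArchDensity t * (∑ l ∈ Finset.range (i + k + 2),
          (((i + k + 1).choose l : ℝ) * (-1) ^ l * a ^ (i + k + 1 - l)) * t ^ (j - 1 - i + l + 1)) -
        weilArchDensity t * ((-a) ^ (i + k + 1) * t ^ (j - 1 - i + 1)) := fun t ↦ by ring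
  simp_rw [hpt]
  rw [integral_sub h1 h2, setIntegral_weilArchDensity_mul_finset_sum_pow_succ ha]
  congr 1
  have h3 : (fun t ↦ weilArchDensity t * ((-a) ^ (i + k + 1) * t ^ (j - 1 - i + 1))) =
      fun t ↦ (-a) ^ (i + k + 1) * (weilArchDensity t * t ^ (j - 1 - i + 1)) := by
    funext t; ring
  rw [h3, MeasureTheory.integral_const_mul]

/-- `ρ(t)(O_{jk}(t) − m_{j+k})` is integrable on `(0, 2a]` (`a > 0`). -/
theorem integrableOn_weilArchDensity_mul_overlapPoly_sub_moment (ha : 0 < a) (j k : ℕ) :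
    IntegrableOn (fun t ↦ weilArchDensity t *
        ((∑ i ∈ Finset.range (j + 1), (j.choose i : ℝ) * t ^ (j - i) *
            (((a - t) ^ (i + k + 1) - (-a) ^ (i + k + 1)) / (i + k + 1))) -
          (a ^ (j + k + 1) - (-a) ^ (j + k + 1)) / (j + k + 1))) (Ioc 0 (2 * a)) := by
  simp_rw [overlapPoly_sub_moment_eq_sum]
  have hA : IntegrableOn (fun t ↦ ∑ i ∈ Finset.range j, (j.choose i : ℝ) / (i + k + 1) * (weilArchDensity t *
      ((∑ l ∈ Finset.range (i + k + 2), ((i + k + 1).choose l : ℝ) * (-1) ^ l * a ^ (i + k + 1 - l) *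
          t ^ (j - 1 - i + l + 1)) - (-a) ^ (i + k + 1) * t ^ (j - 1 - i + 1)))) (Ioc 0 (2 * a)) :=
    integrable_finsetSum _ fun i _ ↦ (integrableOn_weilArchDensity_mul_innerPoly ha j k i).const_mul _
  have hB : IntegrableOn (fun t ↦ 1 / ((j : ℝ) + k + 1) * (weilArchDensity t *
      ∑ l ∈ Finset.range (j + k + 1), ((j + k + 1).choose (l + 1) : ℝ) * (-1) ^ (l + 1) *
        a ^ (j + k + 1 - (l + 1)) * t ^ (l + 1))) (Ioc 0 (2 * a)) := by
    have h := integrable_finsetSum (μ := volume.restrict (Ioc 0 (2 * a))) (Finset.range (j + k + 1))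
      fun l _ ↦ (integrableOn_weilArchDensity_mul_pow_succ ha l).const_mul
        (((j + k + 1).choose (l + 1) : ℝ) * (-1) ^ (l + 1) * a ^ (j + k + 1 - (l + 1)))
    refine IntegrableOn.congr_fun (h.const_mul (1 / ((j : ℝ) + k + 1))) (fun t _ ↦ ?_) measurableSet_Ioc
    rw [Finset.mul_sum, Finset.mul_sum, Finset.mul_sum]
    exact Finset.sum_congr rfl fun l _ ↦ by ring
  refine (hA.add hB).congr_fun (fun t _ ↦ ?_) measurableSet_Ioc
  simp only [Pi.add_apply]
  symm
  rw [mul_add, Finset.mul_sum]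
  congr 1
  · exact Finset.sum_congr rfl fun i _ ↦ by ring
  · ring

/-- **The archimedean window integral of the increment polynomial of two monomial windows through the window constants**
(`a > 0`): with `K_{jk} = 2m_{j+k} − O_{jk} − O_{kj}` exactly as in
`WeilFormatCPolyWindowArch.setIntegral_weilArchDensity_mul_weilIncrementSesq_indicator_pow`,
`∫_{(0,2a]} ρ K_{jk} = −∫_{(0,2a]} ρ (O_{jk} − m_{j+k}) − ∫_{(0,2a]} ρ (O_{kj} − m_{j+k})`, each of the two integrals being the
explicit `W_q(a)`-combination of `setIntegral_weilArchDensity_mul_overlapPoly_sub_moment` (with `(j,k)` resp. `(k,j)`). -/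
theorem setIntegral_weilArchDensity_mul_incrementPoly (ha : 0 < a) (j k : ℕ) :
    ∫ t in Ioc 0 (2 * a), weilArchDensity t *
        (2 * ((a ^ (j + k + 1) - (-a) ^ (j + k + 1)) / (j + k + 1))
          - (∑ i ∈ Finset.range (j + 1), (j.choose i : ℝ) * t ^ (j - i) *
              (((a - t) ^ (i + k + 1) - (-a) ^ (i + k + 1)) / (i + k + 1)))
          - (∑ i ∈ Finset.range (k + 1), (k.choose i : ℝ) * t ^ (k - i) *
              (((a - t) ^ (i + j + 1) - (-a) ^ (i + j + 1)) / (i + j + 1)))) =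
      -(∫ t in Ioc 0 (2 * a), weilArchDensity t *
          ((∑ i ∈ Finset.range (j + 1), (j.choose i : ℝ) * t ^ (j - i) *
              (((a - t) ^ (i + k + 1) - (-a) ^ (i + k + 1)) / (i + k + 1))) -
            (a ^ (j + k + 1) - (-a) ^ (j + k + 1)) / (j + k + 1))) -
        ∫ t in Ioc 0 (2 * a), weilArchDensity t *
          ((∑ i ∈ Finset.range (k + 1), (k.choose i : ℝ) * t ^ (k - i) *
              (((a - t) ^ (i + j + 1) - (-a) ^ (i + j + 1)) / (i + j + 1))) -
            (a ^ (k + j + 1) - (-a) ^ (k + j + 1)) / (k + j + 1)) := by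
  have h1 : IntegrableOn (fun t ↦ -(weilArchDensity t *
        ((∑ i ∈ Finset.range (j + 1), (j.choose i : ℝ) * t ^ (j - i) *
            (((a - t) ^ (i + k + 1) - (-a) ^ (i + k + 1)) / (i + k + 1))) -
          (a ^ (j + k + 1) - (-a) ^ (j + k + 1)) / (j + k + 1)))) (Ioc 0 (2 * a)) :=
    (integrableOn_weilArchDensity_mul_overlapPoly_sub_moment ha j k).neg
  have h2 := integrableOn_weilArchDensity_mul_overlapPoly_sub_moment ha k j
  rw [← integral_neg, ← integral_sub h1 h2]
  refine setIntegral_congr_fun measurableSet_Ioc fun t _ ↦ ?_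
  ring

end Summit.RiemannHypothesis.RiemannHypothesis.Theorems.WeilFormatC

end
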